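import Summits.CriticalPhenomena.PercolationContinuityZ3.Theorems.Transplant.PlanarSkeletonFrmQuasiDefs
import Summits.CriticalPhenomena.PercolationContinuityZ3.Theorems.Transplant.SkelFrmQuasiBChoiceResidF
import Summits.CriticalPhenomena.PercolationContinuityZ3.Theorems.Transplant.SkelFrmBChoiceResidF
import Summits.CriticalPhenomena.PercolationContinuityZ3.Theorems.Transplant.SkelFrmQuasiBParamsKitS
import Summits.CriticalPhenomena.PercolationContinuityZ3.Theorems.Transplant.SkelFrmBParamsKitS
import Summits.CriticalPhenomena.PercolationContinuityZ3.Theorems.Transplant.SkelFrmQuasi1ChoiceDefs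
import Summits.CriticalPhenomena.PercolationContinuityZ3.Theorems.Transplant.SkelFrmQuasiBChoiceResidC
import Summits.CriticalPhenomena.PercolationContinuityZ3.Theorems.Transplant.SkelFrmQuasiBParamsBridgeF
import Summits.CriticalPhenomena.PercolationContinuityZ3.Theorems.Transplant.SkelFrmQuasiBParamsBridgeFrameF
import Summits.CriticalPhenomena.PercolationContinuityZ3.Theorems.Transplant.SkelFrmQuasiBParamsFaceFloorsPiXA
import Summits.CriticalPhenomena.PercolationContinuityZ3.Theorems.Transplant.SkelFrmQuasiBParamsFaceFloorsZPiYA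
import Summits.CriticalPhenomena.PercolationContinuityZ3.Theorems.Transplant.SkelFrmQuasiBParamsLF
import Summits.CriticalPhenomena.PercolationContinuityZ3.Theorems.Transplant.SkelFrmQuasiBParamsLFA
import Summits.CriticalPhenomena.PercolationContinuityZ3.Theorems.Transplant.SkelFrmQuasiBParamsSchedA
import Summits.CriticalPhenomena.PercolationContinuityZ3.Theorems.Transplant.SkelFrmQuasiBParamsSlotsS
import HarnessLib
import Summits.CriticalPhenomena.PercolationContinuityZ3.Theorems.Transplant.SkelFrmBChoiceResidF2
/-!
# GEN-Q PORT (WAVE-Q table v0.8 section 2, row G215, U-level L22; captain R-6/R-7 2026-08-27: carrier token swap `PlanarSkeletonFrmFrom ↦ PlanarSkeletonFrmQuasi`)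
# of the tree module «Transplant/SkelFrmFromBChoiceResidF2» (sha256 55cd045e155b9017…) onto the quasi-step carrier `PlanarSkeletonFrmQuasi` (p507026): «SkelFrmQuasiBChoiceResidF2»

ORIGINAL TITLE: N2 (frames-only node `SamePDropOfSkeletonFrm₁`, OPEN) — (ζ″) ledger: THE (F)-COLUMN EXCESS RESIDUAL OF THE WRAPPER `NegB.exF2` AND ITS FLOOR LEMMAS

builds on p205010 (kernel theorem, internal audit signed; external expert review pending) — nothing in this file uses p205010; NOTHING is claimed about any open node
((N3-b), the end state).  Lane `prim-bschramm`, seat `prim-bschramm-p3` (gen 30; design owner; tool = captain gen-1 g4's port_genq.py R-14 --cone + p3-g30 slot-value patch T1).  Helper file (`--supports stmt-CriticalPhenomena-4575 --as helper`).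
PORT RULES (U-wave r1–r4 re-used, GEN-Q hunk classes of p3-g29 #6136): declaration order, names and proof texts are those of «SkelFrmFromBChoiceResidF2», byte-identical except
(i) the carrier token `PlanarSkeletonFrmFrom ↦ PlanarSkeletonFrmQuasi` in binders, `namespace`/`end` lines and qualified names (module names `SkelFrmFrom… ↦ SkelFrmQuasi…`
in imports of already-ported rows); (ii) `Φ.step ↦ Φ.qstep` with the called Steps lemma replaced by its `…Q`/`_q` twin and the cost `Φ.M` threaded (none in this file unless
listed below); (iii) `Φ.cyl_connected ↦ Φ.cyl_reach` readers (none unless listed); (iv) graph-ball radii / window floors ×`Φ.M` — IN THIS FILE `exF2`'s last component `Φ.M·KS.YbF` (L-gen3-1) and the inherited `exFc = max (Φ.M·πBudX) (Φ.M·πBudY)` (G206) with their floor conjuncts; (v) L-KitS-1 (design-owner ruling 2026-08-27): the (S0) kit data of «SkelFrmQuasiBChoiceNums» (stmt-g33, G017) are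
N-parametrised — IN THIS FILE the readers `KS0.R'0/r₀0/r₀0_ge/base0/reach0 ↦ …N` resp. `KS.RA' ↦ KS.RAN'`, instantiated at `N := KS.NQ Φ = 13·max Φ.M 1`, nothing else.  Carrier-free
residents stay imported/exported from the original «SkelFrmBChoiceResidF2» exactly as in the FrmFrom port.  Docstrings and citations are the original's.

-/

noncomputable section

open scoped Classical

namespace Summit.CriticalPhenomena.PercolationContinuityZ3.Theorems.Transplant

open Literature.Probability.Percolation Literature.Probability.LatticeModels SimpleGraph
open SkelConc (Consts)
open Skelφ.StepI (DataNS OutNS)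
open Neg

namespace PlanarSkeletonFrmQuasi

namespace NegB


-- GEN-Q T3 (p3-g30): residents/aliases of the row-less module(s) «SkelFrmFromBParamsKitA» used below, re-exported here.
export PlanarSkeletonFrmFrom.NegB (Rs)

/-! ## §1 The wrapper's (F)-column excess residual -/

/-- **The (F) wrapper's EXCESS residual** `exF2 mk c := max (exFc mk c) (max (Rs mk) (max (r₀0 mk R_b) (max (r₀0 mk R_L) (Φ.M·YbF c mk))))` — GEN-Q hunk (iv): the LAST component ×`Φ.M` (L-gen3-1, design owner p3-g30:
the quasi face assemblies BVC3Px-Q/BVC5Px-Q read `hπ1 : Φ.M·(|core1Lo 0|+|core1Lo 1|) ≤ r` / `hYbr : Φ.M·YbF ≤ r`, discharged at OfPx from this floor)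
(see the module docstring). [this work] -/
def exF2 (mk c : ℕ) : GSlot := fun κ _ _ _ _ _ Φ t p D g f =>
  max (exFc mk c κ Φ t p D g f) (max (KS.Rs t D mk) (max (KS0.r₀0N (KS.NQ Φ) t D mk (D.R (D.toDataN.scale t (KS.MBF κ Φ t p D c mk) (KS.nBF κ Φ t p D c mk)))) (max (KS0.r₀0N (KS.NQ Φ) t D mk (RLD κ Φ t p D g f)) (Φ.M * KS.YbF κ Φ t p D c mk g f))))

section Floors

variable (κ : Consts) {V : Type} [DecidableEq V] [Countable V] {G : SimpleGraph V} [G.LocallyFinite] (Φ : PlanarSkeletonFrmQuasi G) (t : V) (p : unitInterval)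
  (D : DataNS V) (g f mk c : ℕ)

/-- `exF2` by name. [folklore] -/
theorem exF2_at (κ : Consts) {V : Type} [DecidableEq V] [Countable V] {G : SimpleGraph V} [G.LocallyFinite] (Φ : PlanarSkeletonFrmQuasi G) (t : V) (p : unitInterval) (D : DataNS V) (g : ℕ) (f : ℕ) (mk : ℕ) (c : ℕ) : exF2 mk c κ Φ t p D g f =
    max (exFc mk c κ Φ t p D g f) (max (KS.Rs t D mk) (max (KS0.r₀0N (KS.NQ Φ) t D mk (D.R (D.toDataN.scale t (KS.MBF κ Φ t p D c mk) (KS.nBF κ Φ t p D c mk)))) (max (KS0.r₀0N (KS.NQ Φ) t D mk (RLD κ Φ t p D g f)) (Φ.M * KS.YbF κ Φ t p D c mk g f)))) := rfl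

/-- **The five floors inside `exF2`**: `exFc ≤ exF2`, `Rs ≤ exF2`, `r₀0 R_b ≤ exF2`, `r₀0 R_L ≤ exF2`, `Φ.M·YbF ≤ exF2`. [folklore] -/
theorem exF2_floors (κ : Consts) {V : Type} [DecidableEq V] [Countable V] {G : SimpleGraph V} [G.LocallyFinite] (Φ : PlanarSkeletonFrmQuasi G) (t : V) (p : unitInterval) (D : DataNS V) (g : ℕ) (f : ℕ) (mk : ℕ) (c : ℕ) : exFc mk c κ Φ t p D g f ≤ exF2 mk c κ Φ t p D g f ∧ KS.Rs t D mk ≤ exF2 mk c κ Φ t p D g f ∧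
    KS0.r₀0N (KS.NQ Φ) t D mk (D.R (D.toDataN.scale t (KS.MBF κ Φ t p D c mk) (KS.nBF κ Φ t p D c mk))) ≤ exF2 mk c κ Φ t p D g f ∧
      KS0.r₀0N (KS.NQ Φ) t D mk (RLD κ Φ t p D g f) ≤ exF2 mk c κ Φ t p D g f ∧ Φ.M * KS.YbF κ Φ t p D c mk g f ≤ exF2 mk c κ Φ t p D g f := by
  refine ⟨?_, ?_, ?_, ?_, ?_⟩ <;> rw [exF2_at] <;> omega

/-- **The derived floors**: `base0 ≤ exF2`, `reach0 ≤ exF2`, `R_b + reach0 ≤ exF2`, `R_L + reach0 ≤ exF2`, `Φ.M·πBudX ≤ exF2`, `Φ.M·πBudY ≤ exF2`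
(`r₀0 X = max base0 (X + reach0)` at `N := KS.NQ Φ`; `exFc = max (Φ.M·πBudX) (Φ.M·πBudY)` — ×M of record, G206). [folklore] -/
theorem exF2_floors' (κ : Consts) {V : Type} [DecidableEq V] [Countable V] {G : SimpleGraph V} [G.LocallyFinite] (Φ : PlanarSkeletonFrmQuasi G) (t : V) (p : unitInterval) (D : DataNS V) (g : ℕ) (f : ℕ) (mk : ℕ) (c : ℕ) : KS0.base0N (KS.NQ Φ) t D mk ≤ exF2 mk c κ Φ t p D g f ∧ KS0.reach0N (KS.NQ Φ) t D mk ≤ exF2 mk c κ Φ t p D g f ∧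
    (D.R (D.toDataN.scale t (KS.MBF κ Φ t p D c mk) (KS.nBF κ Φ t p D c mk))) + KS0.reach0N (KS.NQ Φ) t D mk ≤ exF2 mk c κ Φ t p D g f ∧
      (RLD κ Φ t p D g f) + KS0.reach0N (KS.NQ Φ) t D mk ≤ exF2 mk c κ Φ t p D g f ∧
        Φ.M * KS.πBudX κ Φ t p D c mk g f ≤ exF2 mk c κ Φ t p D g f ∧ Φ.M * KS.πBudY κ Φ t p D c mk g f ≤ exF2 mk c κ Φ t p D g f := by
  obtain ⟨h1, -, h3, h4, -⟩ := exF2_floors κ Φ t p D g f mk c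
  have hb := KS0.r₀0N_ge (KS.NQ Φ) t D mk (D.R (D.toDataN.scale t (KS.MBF κ Φ t p D c mk) (KS.nBF κ Φ t p D c mk)))
  have hl := KS0.r₀0N_ge (KS.NQ Φ) t D mk (RLD κ Φ t p D g f)
  have hc := exFc_floors κ Φ t p D g f mk c
  omega

end Floors

/-! ## §2 Transfer to a dominating slot value -/

section Transfer

variable {κ : Consts} {V : Type} [DecidableEq V] [Countable V] {G : SimpleGraph V} [G.LocallyFinite] {Φ : PlanarSkeletonFrmQuasi G} {t : V} {p : unitInterval}
  {mk c : ℕ}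

-- GEN-Q (R-2, captain 2026-08-27): `PlanarSkeletonFrmFrom.NegB.exFc_le_of_ge2` is not in the used cone of the node top — not ported.

/-- **The slot rows' floors at `(D, g, f)`** from any excess residual dominating `exF2`: `Rs ≤ ex`, `r₀0 R_b ≤ ex`, `r₀0 R_L ≤ ex`, `Φ.M·YbF ≤ ex`,
`base0 ≤ ex`, `reach0 ≤ ex`, `πBudX ≤ ex`, `πBudY ≤ ex`. [folklore] -/
theorem floors_of_ge2 {κ : Consts} {V : Type} [DecidableEq V] [Countable V] {G : SimpleGraph V} [G.LocallyFinite] {Φ : PlanarSkeletonFrmQuasi G} {t : V} {p : unitInterval} {mk : ℕ} {c : ℕ} {ex : GSlot} (h : ∀ (D : DataNS V) (g f : ℕ), exF2 mk c κ Φ t p D g f ≤ ex κ Φ t p D g f) (D : DataNS V) (g f : ℕ) :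
    KS.Rs t D mk ≤ ex κ Φ t p D g f ∧ KS0.r₀0N (KS.NQ Φ) t D mk (D.R (D.toDataN.scale t (KS.MBF κ Φ t p D c mk) (KS.nBF κ Φ t p D c mk))) ≤ ex κ Φ t p D g f ∧
      KS0.r₀0N (KS.NQ Φ) t D mk (RLD κ Φ t p D g f) ≤ ex κ Φ t p D g f ∧ Φ.M * KS.YbF κ Φ t p D c mk g f ≤ ex κ Φ t p D g f ∧
        KS0.base0N (KS.NQ Φ) t D mk ≤ ex κ Φ t p D g f ∧ KS0.reach0N (KS.NQ Φ) t D mk ≤ ex κ Φ t p D g f ∧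
          Φ.M * KS.πBudX κ Φ t p D c mk g f ≤ ex κ Φ t p D g f ∧ Φ.M * KS.πBudY κ Φ t p D c mk g f ≤ ex κ Φ t p D g f := by
  have hx := h D g f
  obtain ⟨-, h2, h3, h4, h5⟩ := exF2_floors κ Φ t p D g f mk c
  obtain ⟨h6, h7, -, -, h8, h9⟩ := exF2_floors' κ Φ t p D g f mk c
  exact ⟨h2.trans hx, h3.trans hx, h4.trans hx, h5.trans hx, h6.trans hx, h7.trans hx, h8.trans hx, h9.trans hx⟩

end Transfer

/-! ## §3 The (F) demand on the rim-diameter slot: `mxF` (hp-8 g44; the node tuple's `mxR := NegB.mxF 0`, lead g14 J27 / coherence rule) -/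

/-- **The (F) column's RIM-DIAMETER demand** `mxF mk : GSlot := ⌈m_F⌉₊` — the face block ceiling `(prFA D g f).mF (fcellsA D g f)` as a natural number
(`Int.toNat`; the wrapper's `hmx : m_F ≤ mx` holds at any `mx ⊒ mxF mk`; the index `mk` is carried for the tuple's uniform shape only). [this work] -/
def mxF (_mk : ℕ) : GSlot := fun κ _ _ _ _ _ Φ t p D g f => ((prFA κ Φ t p D g f).mF (fcellsA κ Φ t p D g f)).toNat

section MxF

variable (κ : Consts) {V : Type} [DecidableEq V] [Countable V] {G : SimpleGraph V} [G.LocallyFinite] (Φ : PlanarSkeletonFrmQuasi G) (t : V) (p : unitInterval)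
  (D : DataNS V) (g f mk : ℕ)

/-- `mxF` by name. [folklore] -/
theorem mxF_at (κ : Consts) {V : Type} [DecidableEq V] [Countable V] {G : SimpleGraph V} [G.LocallyFinite] (Φ : PlanarSkeletonFrmQuasi G) (t : V) (p : unitInterval) (D : DataNS V) (g : ℕ) (f : ℕ) (mk : ℕ) : mxF mk κ Φ t p D g f = ((prFA κ Φ t p D g f).mF (fcellsA κ Φ t p D g f)).toNat := rfl

/-- **`hmx` at `mx := mxF mk`**: `m_F ≤ mxF mk` (in `ℤ`). [folklore] -/
theorem mF_le_mxF (κ : Consts) {V : Type} [DecidableEq V] [Countable V] {G : SimpleGraph V} [G.LocallyFinite] (Φ : PlanarSkeletonFrmQuasi G) (t : V) (p : unitInterval) (D : DataNS V) (g : ℕ) (f : ℕ) (mk : ℕ) : (prFA κ Φ t p D g f).mF (fcellsA κ Φ t p D g f) ≤ (((mxF mk κ Φ t p D g f) : ℕ) : ℤ) := by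
  rw [mxF_at]; exact Int.self_le_toNat _

-- GEN-Q (R-2, captain 2026-08-27): `PlanarSkeletonFrmFrom.NegB.mF_le_of_ge` is not in the used cone of the node top — not ported.

end MxF

end NegB

end PlanarSkeletonFrmQuasi

end Summit.CriticalPhenomena.PercolationContinuityZ3.Theorems.Transplant

end
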